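import Summits.BirchSwinnertonDyer.BirchSwinnertonDyer.Theorems.TeichmullerTwistDescentTwistedPeriodLatticeSaturationOfNoCaseOne
import Summits.BirchSwinnertonDyer.BirchSwinnertonDyer.Theses.EdixhovenFibreFiveSeven
import HarnessLib

/-!
# Cross-route link: EF57's TDS11 `TwistDegreeStepOrdinary` (stmt-BirchSwinnertonDyer-22228) follows from
# TTD's GE11 `OrdinaryLowValuationOptimalManinUnitGeEleven` (stmt-23885), hence from
# K `TwistedPeriodLatticeSaturation` (stmt-25368) granted the cite bundle 25370 — BY NAME

Cell `pub/bsd-wall`, seat `bsd-line-ttd-p1` (g5). THEOREMS ONLY; CONDITIONAL results (`proof.conditional`),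
nothing is closed. With `TwistedPeriodLatticeSaturation ⟺ OrdinaryLowValuationOptimalManinUnitGeEleven`
(`twistedPeriodLatticeSaturation_iff_geEleven`, p612025) this file records that the three open Manin cruxes
{K 25368, GE11 23885} of route `TeichmullerTwistDescent` and TDS11 22228 of route `EdixhovenFibreFiveSeven`
are ONE open problem (Edixhoven 1991 §4 "case 1" at `p ≥ 11`) in three currencies:

* `twistDegreeStepOrdinary_of_geEleven : GE11 → TDS11` — at a TDS11 frame `(W, p, V, W♭)` take the
  `X₀(N)`-optimal member `W₀ ∼ V` (`X12.exists_isIsogenous_optimal`, modularity = TDS11's own first binder),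
  which is additive, irreducible, `(G)`-ordinary (`TypeGOrd.of_isIsogenous`) and unstarred (Dokchitser–
  Dokchitser along a prime-to-`p` cyclic isogeny, a tree theorem); GE11 gives `p ∤ c(D₀)` for its
  lattice-optimal datum; the AKR translation
  `ManinFrameResidueProperTwistDegree.twistDegreeStep_of_exists_member_not_dvd_c` (prime-to-`p` transport
  + the twist identity) yields the degree step. The residue and degree clauses of TDS11 are idle.
* `twistDegreeStepOrdinary_of_facts_of_twistedPeriodLatticeSaturation :
  EdixhovenKodairaAndModularityFacts → K → TDS11`.
BSD / W-ALL / Manin's conjecture are not proved by this. [cite: EdixhovenManin1991, Thm. 3 and §4]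
[cite: DokchitserDokchitser2015LocalInvariants, Thm. 5.1 (1)] [cite: ZagierCMB1985, §1]
-/

set_option autoImplicit false
-- single-conjunct summit: `Summit.BirchSwinnertonDyer.BirchSwinnertonDyer.…` repeats the name by design
set_option linter.dupNamespace false

noncomputable section

open scoped Classical

open WeierstrassCurve Literature.NumberTheory.EllipticCurves Literature.NumberTheory.EllipticCurves.ModularForms
  Literature.NumberTheory.EllipticCurves.Rank1Residual
  Summit.BirchSwinnertonDyer.Rank1Residual Summit.BirchSwinnertonDyer.Rank1Residual.Additive
  Summit.BirchSwinnertonDyer.BirchSwinnertonDyer.Theorems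

namespace Summit.BirchSwinnertonDyer.BirchSwinnertonDyer.Theorems.EdixhovenFibreFiveSevenTwistDegreeStepOrdinaryOfGeEleven

/-- Level bookkeeping: a `p`-good datum at level `N` is one at any equal level. [folklore] -/
private theorem exists_datum_not_dvd_of_level_eq' {X : WeierstrassCurve ℚ} {N M : ℕ} [NeZero N]
    [NeZero M] (h : N = M) {p : ℕ} (D : ModularParametrizationData X N) (hc : ¬ (p : ℤ) ∣ D.c) :
    ∃ D' : ModularParametrizationData X M, ¬ (p : ℤ) ∣ D'.c := by
  subst h
  exact ⟨D, hc⟩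

/-- **TDS11 ⟸ GE11** (EF57 stmt-22228 from TTD stmt-23885, by name). At a TDS11 frame the `X₀(N)`-optimal
member `W₀` of the class of the unstarred `(G)`-ordinary `V` is itself additive, irreducible, `(G)`-ordinary
and unstarred, so GE11 gives `p ∤ c` for its lattice-optimal conductor-level datum, and the AKR translation
`twistDegreeStep_of_exists_member_not_dvd_c` turns that member into the twist-degree step at `(V, W♭)`.
[cite: EdixhovenManin1991, Thm. 3 and §4] [cite: DokchitserDokchitser2015LocalInvariants, Thm. 5.1 (1)] -/
theorem twistDegreeStepOrdinary_of_geEleven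
    (h11 : Summit.BirchSwinnertonDyer.BirchSwinnertonDyer.Theses.TeichmullerTwistDescent.OrdinaryLowValuationOptimalManinUnitGeEleven) :
    Summit.BirchSwinnertonDyer.BirchSwinnertonDyer.Theses.EdixhovenFibreFiveSeven.TwistDegreeStepOrdinary := by
  intro hnf W _ _ p _ _ hp11 hadd hirr _hres _hall V _ _ _ Wf _ _ _ C hisoV hG hV4 hC
  have hpP : p.Prime := Fact.out
  have hp2 : p ≠ 2 := by omega
  have hp5 : 5 ≤ p := by omega
  -- the unstarred member `V`
  have hirrV : Irr V p := (X12.irr_iff_of_isIsogenous hisoV p).mp hirr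
  have hV : Addv V p := (X2.addv_iff_of_isIsogenous (p := p) hisoV).mp hadd
  have hjV : 0 ≤ padicValRat p V.j := padicValRat_j_nonneg_of_typeGOrd V p hG
  -- the optimal member `W₀ ∼ V` with its lattice-optimal conductor-level datum
  obtain ⟨W₀, hE₀, hM₀, hNz₀, D₀, hiso₀, hN₀, hopt₀⟩ := X12.exists_isIsogenous_optimal hnf V
  haveI := hE₀
  haveI := hM₀
  haveI := hNz₀
  have hadd₀ : Addv W₀ p := (X2.addv_iff_of_isIsogenous (p := p) hiso₀).mp hV
  have hirr₀ : Irr W₀ p := (X12.irr_iff_of_isIsogenous hiso₀ p).mp hirrV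
  have hG₀ : TypeGOrd W₀ p := hG.of_isIsogenous hp2 hV hiso₀
  have hV4₀ : padicValInt p W₀.minimalDiscriminantInt ≤ 4 := by
    obtain ⟨ψ, hψ⟩ := hiso₀.exists_isCyclic
    have hdeg : ¬ p ∣ ψ.degree := X11b.not_dvd_degree_of_isCyclic_of_irr ψ hψ hpP hirrV
    rw [← dokchitser_padicValInt_minimalDiscriminantInt_eq_of_isogeny_of_not_dvd_degree_holds V W₀ ψ
      p hpP hdeg hjV]
    exact hV4
  -- GE11 at `(W₀, D₀)`
  have hc₀ : ¬ (p : ℤ) ∣ D₀.c := h11 W₀ p D₀ hp11 hadd₀ hirr₀ hG₀ hV4₀ hopt₀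
  -- the same datum at level `N(W)` and the translation into the degree step
  have hisoW₀ : IsIsogenous W W₀ := hisoV.trans' hiso₀
  have hN : W₀.conductorNorm ℤ = W.conductorNorm ℤ :=
    IsNewformOf.level_eq_conductorNorm_of_exists_isNewformOf hnf (D₀.isNewformOf.of_isIsogenous hisoW₀)
  obtain ⟨D₀', hc₀'⟩ := exists_datum_not_dvd_of_level_eq' hN D₀ hc₀
  exact ManinFrameResidueProperTwistDegree.twistDegreeStep_of_exists_member_not_dvd_c hnf W hp5 hadd hirr
    hisoV hG hV4 C hC ⟨W₀, hE₀, hM₀, D₀', hisoW₀, hc₀'⟩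

/-- **TDS11 ⟸ `EdixhovenKodairaAndModularityFacts` (TTD stmt-25370) ∧ K `TwistedPeriodLatticeSaturation`
(TTD stmt-25368)**: `twistDegreeStepOrdinary_of_geEleven` after `twistedPeriodLatticeSaturation_iff_geEleven`.
[cite: EdixhovenManin1991, Thm. 3 and §4] -/
theorem twistDegreeStepOrdinary_of_facts_of_twistedPeriodLatticeSaturation
    (hF : Summit.BirchSwinnertonDyer.BirchSwinnertonDyer.Theses.TeichmullerTwistDescent.EdixhovenKodairaAndModularityFacts)
    (hK : Summit.BirchSwinnertonDyer.BirchSwinnertonDyer.Theses.TeichmullerTwistDescent.TwistedPeriodLatticeSaturation) :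
    Summit.BirchSwinnertonDyer.BirchSwinnertonDyer.Theses.EdixhovenFibreFiveSeven.TwistDegreeStepOrdinary :=
  twistDegreeStepOrdinary_of_geEleven
    ((TeichmullerTwistDescent.twistedPeriodLatticeSaturation_iff_geEleven hF).mp hK)

end Summit.BirchSwinnertonDyer.BirchSwinnertonDyer.Theorems.EdixhovenFibreFiveSevenTwistDegreeStepOrdinaryOfGeEleven

end
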